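import Summits.ValiantsHypothesis.ValiantsHypothesis.Theorems.BarrierLeverChowBenchmarkPairsBlockPeelLabels
import Summits.ValiantsHypothesis.ValiantsHypothesis.Theorems.BarrierLeverPartitionMinorsMooreBenchRows

/-!
# Route BarrierLever — item 22038 `ChowBenchmarkPairs`, line `moore-peel`: the BLOCK PEEL, IV — the weighted
# Vandermonde matrix of the ratios, the window identity for `adj J^κ(i,t)`, and Kronecker cancellation

Helper file (`--supports stmt-ValiantsHypothesis-22038`; cell valiant-natproofs, rung V4, 𝒟-side benchmark of
record, line `moore_peel`, planner kernel target **K1** (HOME/STATUS.md l.1746); seat val-np-p4 gen 29).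
Closes NO item.  One auxiliary definition (`ratioVandermonde`); the algebraic inputs of STAGE REDUCTION II
(`…BlockPeelLead`; memo `HOME/val-np-p4/g28/memo/MEMO-valnp4-g28.md` §1: the generalised Vandermonde factors
`V_c(λ)` and the block determinant `det J(i,t)`).

* `ratioVandermonde κ i Λ = [κ|T_{i+s''}| · Λ_s^{i+s''}]_{s,s''}` = `diag(Λ^i) · Vandermonde(Λ) · diag(κ)`
  (`ratioVandermonde_eq`); `det_ratioVandermonde_ne_zero` for distinct symbolic ratios `X_{n+s}` and `κ`
  without zeros.
* `adjugate_mul_blockMatrix_window` — `Σ_ρ adj(J)[ρ', ρ] · J̃[ρ, c_i + pos ρ''] = det J · [ρ' = ρ'']`;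
  `exists_blockIdx_of_mem_window` — every code of the multi-window `[c_i, c_{i+t})` is a block position.
* `kronecker_adjugate_cancel` — `(1 ⊗ V)(1 ⊗ adj V) = det V · 1` after a ring map.

WHAT THIS IS NOT: no stub of line `moore_peel` is closed; `stub_segmentMeanValue` (∀ h) is untouched; nothing
on crux stmt-ValiantsHypothesis-14610 or on `VP` versus `VNP`.
-/

set_option linter.dupNamespace false

namespace Summit.ValiantsHypothesis.ValiantsHypothesis.Theorems.BarrierLever.MoorePeel

open Polynomial Finset

/-! ## 4. The weighted Vandermonde matrix of the ratios -/

/-- **The weighted Vandermonde matrix of the ratios**: `V[s, s''] = κ(|T_{i+s''}|) · Λ_s^{i+s''}` — the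
coefficient of `X^{i+s''} · (T_{i+s''}, {c})` in the reduced external row `(c, n+s)`. -/
def ratioVandermonde {R : Type*} [CommRing R] (κ : ℕ → ℕ) (i : ℕ) {t : ℕ} (Λ : Fin t → R) :
    Matrix (Fin t) (Fin t) R :=
  Matrix.of fun s s'' => ((κ (bits (i + (s'' : ℕ))).card : ℕ) : R) * Λ s ^ (i + (s'' : ℕ))

/-- `V = diag(Λ_s^i) · Vandermonde(Λ) · diag(κ|T_{i+s''}|)`. -/
theorem ratioVandermonde_eq {R : Type*} [CommRing R] (κ : ℕ → ℕ) (i : ℕ) {t : ℕ} (Λ : Fin t → R) :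
    ratioVandermonde κ i Λ = Matrix.diagonal (fun s => Λ s ^ i) * Matrix.vandermonde Λ *
      Matrix.diagonal (fun s'' : Fin t => (((κ (bits (i + (s'' : ℕ))).card : ℕ) : R))) := by
  ext s s''
  rw [Matrix.mul_diagonal, Matrix.diagonal_mul, Matrix.vandermonde_apply, ratioVandermonde, Matrix.of_apply,
    pow_add]
  ring

/-- With `κ` zero-free and DISTINCT symbolic ratios `Λ_s = X_{n+s}` (`n + t ≤ h`), `det V ≠ 0`. -/
theorem det_ratioVandermonde_ne_zero (κ : ℕ → ℕ) (hκ : ∀ k, κ k ≠ 0) (h i n t : ℕ) (hnt : n + t ≤ h) :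
    (ratioVandermonde κ i (fun s : Fin t => nodeY h (n + (s : ℕ)))).det ≠ 0 := by
  have hX : ∀ s : Fin t, nodeY h (n + (s : ℕ)) =
      (MvPolynomial.X ⟨n + (s : ℕ), by have := s.2; omega⟩ : MvPolynomial (Fin h) ℂ) := by
    intro s
    rw [nodeY, dif_pos]
  rw [ratioVandermonde_eq, Matrix.det_mul, Matrix.det_mul, Matrix.det_diagonal, Matrix.det_diagonal]
  refine mul_ne_zero (mul_ne_zero ?_ ?_) ?_
  · refine Finset.prod_ne_zero_iff.mpr fun s _ => pow_ne_zero _ ?_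
    rw [hX]
    exact MvPolynomial.X_ne_zero _
  · intro h0
    obtain ⟨s, s', hss, hne⟩ := Matrix.det_vandermonde_eq_zero_iff.mp h0
    rw [hX, hX] at hss
    have := MvPolynomial.X_injective hss
    simp only [Fin.mk.injEq] at this
    exact hne (Fin.ext (by omega))
  · refine Finset.prod_ne_zero_iff.mpr fun s _ => ?_
    exact_mod_cast hκ _

/-! ## 5. The block rows against the adjugate of the block matrix -/

/-- **The window identity**: `Σ_ρ adj(J)[ρ', ρ] · J̃[ρ, c_i + pos ρ''] = det J · [ρ' = ρ'']`. -/
theorem adjugate_mul_blockMatrix_window {R : Type*} [CommRing R] (κ : ℕ → ℕ) (i t : ℕ) (Λ : Fin t → R)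
    (ρ' ρ'' : BlockIdx i t) :
    ∑ ρ, (blockMatrix κ i t Λ).adjugate ρ' ρ * blockEntry κ i Λ ρ (windowStart i + (finSigmaFinEquiv ρ'' : ℕ)) =
      if ρ' = ρ'' then (blockMatrix κ i t Λ).det else 0 := by
  have e : ∀ ρ, blockEntry κ i Λ ρ (windowStart i + (finSigmaFinEquiv ρ'' : ℕ)) = blockMatrix κ i t Λ ρ ρ'' :=
    fun ρ => rfl
  simp_rw [e]
  rw [← Matrix.mul_apply, Matrix.adjugate_mul, Matrix.smul_apply, Matrix.one_apply, smul_eq_mul, mul_ite,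
    mul_one, mul_zero]

/-- A code in the multi-window `[c_i, c_{i+t})` is the position of a unique block row. -/
theorem exists_blockIdx_of_mem_window {i t col : ℕ} (h1 : windowStart i ≤ col) (h2 : col < windowStart (i + t)) :
    ∃ ρ : BlockIdx i t, col = windowStart i + (finSigmaFinEquiv ρ : ℕ) := by
  rw [windowStart_add_blockWidth] at h2
  refine ⟨finSigmaFinEquiv.symm ⟨col - windowStart i, by simp only [blockWidth] at h2; omega⟩, ?_⟩
  rw [Equiv.apply_symm_apply]
  show col = windowStart i + (col - windowStart i)
  omega

/-- **Kronecker cancellation**: `(1 ⊗ V) · (1 ⊗ adj V) = det V · 1` after a ring map `f`. -/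
theorem kronecker_adjugate_cancel {A S : Type*} [CommRing A] [CommRing S] (f : A →+* S) {m τ : Type*}
    [Fintype m] [DecidableEq m] [Fintype τ] [DecidableEq τ] (V : Matrix τ τ A) :
    (Matrix.of fun (cs cs' : m × τ) => if cs.1 = cs'.1 then f (V cs.2 cs'.2) else 0) *
      (Matrix.of fun (cs' cs : m × τ) => if cs'.1 = cs.1 then f (V.adjugate cs'.2 cs.2) else 0) =
      f V.det • (1 : Matrix (m × τ) (m × τ) S) := by
  ext a b
  rw [Matrix.mul_apply, Matrix.smul_apply, Matrix.one_apply, smul_eq_mul, Fintype.sum_prod_type]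
  simp only [Matrix.of_apply]
  have inner : ∀ c : m, ∑ s : τ, (if a.1 = c then f (V a.2 s) else 0) *
      (if c = b.1 then f (V.adjugate s b.2) else 0) =
      if a.1 = c then (if c = b.1 then f ((V * V.adjugate) a.2 b.2) else 0) else 0 := by
    intro c
    by_cases h1 : a.1 = c
    · by_cases h2 : c = b.1
      · simp only [h1, h2, if_true, Matrix.mul_apply, map_sum, map_mul]
      · simp [h2]
    · simp [h1]
  rw [Finset.sum_congr rfl fun c _ => inner c, Finset.sum_ite_eq Finset.univ a.1]
  simp only [Finset.mem_univ, if_true]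
  rw [Matrix.mul_adjugate, Matrix.smul_apply, Matrix.one_apply, smul_eq_mul]
  by_cases hab : a.1 = b.1
  · rw [if_pos hab]
    by_cases h2 : a.2 = b.2
    · rw [if_pos h2, mul_one, if_pos (Prod.ext hab h2), mul_one]
    · rw [if_neg h2, mul_zero, map_zero, if_neg (fun e => h2 (congrArg Prod.snd e)), mul_zero]
  · rw [if_neg hab, if_neg (fun e => hab (congrArg Prod.fst e)), mul_zero]

end Summit.ValiantsHypothesis.ValiantsHypothesis.Theorems.BarrierLever.MoorePeel
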